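import Summits.BirchSwinnertonDyer.BirchSwinnertonDyer.Theorems.ResidualThetaTransportAtTwoThetaLayerLambdaCongruenceAtTwoDepletedHeckeCurve
import Summits.BirchSwinnertonDyer.BirchSwinnertonDyer.Theorems.ResidualThetaTransportAtTwoThetaLayerLambdaCongruenceAtTwoDepletionMonotone
import Literature.NumberTheory.EllipticCurves.HasseWeilAbelianBadReduction
import Literature.NumberTheory.EllipticCurves.RootNumberAtkinLehnerSemistableProofs
import Literature.NumberTheory.DiophantineGeometry.LocalReduction
import HarnessLib

/-!
# Crux `ThetaLayerLambdaCongruenceAtTwo` (stmt-BirchSwinnertonDyer-20688, route ResidualThetaTransportAtTwo), line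
# `birth`: the crux's curve-side Euler polynomials `L_v(W, X)` ARE `1 − a_ℓ(W) X + 𝟙_{ℓ∤N_W} ℓ X²`, hence the curve's
# `S₀`-depleted plus symbol IN THE CRUX'S OWN FORM is full-Hecke eigen (width prover bsd-wall-rtt-p3-w2 g0;
# `--supports stmt-BirchSwinnertonDyer-20688 --as helper`; closes nothing)

HONEST FRAMING. THEOREMS of the tree's definitions only; nothing about any curve or form is asserted beyond the
hypotheses; BSD is not proved by any of this.

WHAT. §1 `map_localPolynomialAt_eq` — for an elliptic, globally minimal `W/ℚ` and every finite place `v` (prime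
`ℓ = ℓ_v`): `L_v(W, X) = 1 − a_ℓ(W)·X + 𝟙_{ℓ ∤ N_W}·ℓ·X²` in `ℚ̄₂[X]`, with `a_ℓ(W) = W.LFunction ℓ` the Dirichlet
coefficient: by the reduction trichotomy — good: `1 − a_v T + q_v T²` (`localPolynomialAt_eq_of_good`, `a_v = a_ℓ`
`LFunction_apply_prime_eq_frobeniusTrace`, `ℓ ∤ N_W`); split/non-split multiplicative: `1 ∓ T`, `a_ℓ = ±1`
(`localPolynomialAt_of_hasSplitMultiplicativeReductionAt`, `LFunction_apply_primesEquiv_of_…`); additive: `1`,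
`a_ℓ = 0`; and `ℓ ∣ N_W` iff bad (`dvd_conductorNorm_iff`). §2 Consequently the curve-side theorems of
`…DepletedHeckeCurve.lean` hold for the depleted rational plus symbol written EXACTLY as in the crux / in
`depletedCurveLayer_eq_layerSum_depletedSymbol` (Euler polynomials `(W.localPolynomialAt v).map ℤ→ℚ̄₂`):
`heckeT_depletedCurveSymbol_localPolynomialAt` (`a_q(W)·φ^{S₀}_W = U_q φ^{S₀}_W + 𝟙_{q∤N_W}[q]φ^{S₀}_W` off `S₀`) and
`heckeU_depletedCurveSymbol_localPolynomialAt_eq_zero` (`U_ℓ φ^{S₀}_W = 0` on `S₀`).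

References: [SilvermanAEC2009] §C.16 (local factors), Ex. 8.19(a); [DiamondShurman2005] §8.3; [GreenbergVatsal2000] §1 (8).
-/

noncomputable section

-- justification: the `Summit.BirchSwinnertonDyer.BirchSwinnertonDyer.…` path repeats a component (route-file convention)
set_option linter.dupNamespace false

open scoped Classical

open Polynomial

open Literature.NumberTheory.EllipticCurves Literature.NumberTheory.EllipticCurves.ModularForms

namespace Summit.BirchSwinnertonDyer.BirchSwinnertonDyer.Theorems.ThetaLayerLambdaCongruenceAtTwo

/-! ## §1. `L_v(W, X) = 1 − a_ℓ(W) X + 𝟙_{ℓ∤N_W} ℓ X²` -/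

section Euler

variable (W : WeierstrassCurve ℚ) [W.IsElliptic] [W.IsGloballyMinimal]

/-- `(primesEquiv v : ℕ) = ℓ_v` (definitional). [folklore] -/
theorem coe_primesEquiv_eq_natGenerator (v : IsDedekindDomain.HeightOneSpectrum (NumberField.RingOfIntegers ℚ)) :
    ((Rat.HeightOneSpectrum.primesEquiv v : Nat.Primes) : ℕ) = Rat.HeightOneSpectrum.natGenerator v := rfl

/-- **`L_v(W, X) = 1 − a_ℓ(W)·X + 𝟙_{ℓ∤N_W}·ℓ·X²` in `ℚ̄₂[X]`** for every finite place `v` of `ℚ` (`ℓ = ℓ_v`,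
`a_ℓ(W) = W.LFunction ℓ`): the reduction trichotomy at `v` — good (`1 − a_v T + ℓ T²`, `a_v = a_ℓ(W)`, `ℓ ∤ N_W`),
split / non-split multiplicative (`1 ∓ T`, `a_ℓ = ±1`, `ℓ ∣ N_W`), additive (`1`, `a_ℓ = 0`, `ℓ ∣ N_W`).
[cite: SilvermanAEC2009, §C.16 (definition of L_v(T)) and Exercise 8.19(a)] -/
theorem map_localPolynomialAt_eq (v : IsDedekindDomain.HeightOneSpectrum (NumberField.RingOfIntegers ℚ)) :
    (W.localPolynomialAt v).map (Int.castRingHom (PadicAlgCl 2)) =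
      1 - C ((W.LFunction (Rat.HeightOneSpectrum.natGenerator v) : PadicAlgCl 2)) * X +
        (if Rat.HeightOneSpectrum.natGenerator v ∣ W.conductorNorm ℤ then 0
          else C (Rat.HeightOneSpectrum.natGenerator v : PadicAlgCl 2)) * X ^ 2 := by
  haveI : Fact (Rat.HeightOneSpectrum.natGenerator v).Prime := ⟨Rat.HeightOneSpectrum.prime_natGenerator v⟩
  rcases WeierstrassCurve.hasGoodReductionAt_or_hasMultiplicativeReductionAt_or_hasAdditiveReductionAt v W with
      hgood | hmul | hadd
  · -- good reduction
    have hndvd : ¬ Rat.HeightOneSpectrum.natGenerator v ∣ W.conductorNorm ℤ :=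
      fun h ↦ (WeierstrassCurve.dvd_conductorNorm_iff W v).mp h hgood
    have ha : W.LFunction (Rat.HeightOneSpectrum.natGenerator v) = W.frobeniusTrace (Rat.HeightOneSpectrum.natGenerator v) :=
      WeierstrassCurve.LFunction_apply_prime_eq_frobeniusTrace W _
        ((WeierstrassCurve.hasGoodReductionAtPrime_iff_hasGoodReductionAt_ringOfIntegers v W).mpr hgood)
    rw [localPolynomialAt_eq_of_good hgood, if_neg hndvd, ha]
    simp only [Polynomial.map_add, Polynomial.map_sub, Polynomial.map_mul, Polynomial.map_pow, Polynomial.map_one,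
      Polynomial.map_X, Polynomial.map_C]
    simp only [eq_intCast, Int.cast_natCast]
  · -- multiplicative reduction
    have hdvd : Rat.HeightOneSpectrum.natGenerator v ∣ W.conductorNorm ℤ :=
      (WeierstrassCurve.dvd_conductorNorm_iff W v).mpr hmul.not_hasGoodReductionAt
    rw [if_pos hdvd, zero_mul, add_zero]
    by_cases hsplit : W.HasSplitMultiplicativeReductionAt v
    · rw [WeierstrassCurve.localPolynomialAt_of_hasSplitMultiplicativeReductionAt hsplit,
        ← coe_primesEquiv_eq_natGenerator, W.LFunction_apply_primesEquiv_of_hasSplitMultiplicativeReductionAt hsplit]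
      simp
    · rw [WeierstrassCurve.localPolynomialAt_of_hasMultiplicativeReductionAt_of_not_hasSplitMultiplicativeReductionAt
        hmul hsplit, ← coe_primesEquiv_eq_natGenerator,
        W.LFunction_apply_primesEquiv_of_hasMultiplicativeReductionAt_of_not_split hmul hsplit]
      simp
  · -- additive reduction
    have hdvd : Rat.HeightOneSpectrum.natGenerator v ∣ W.conductorNorm ℤ :=
      (WeierstrassCurve.dvd_conductorNorm_iff W v).mpr hadd.not_hasGoodReductionAt
    rw [if_pos hdvd, zero_mul, add_zero, WeierstrassCurve.localPolynomialAt_of_hasAdditiveReductionAt hadd,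
      ← coe_primesEquiv_eq_natGenerator, W.LFunction_apply_primesEquiv_of_hasAdditiveReductionAt hadd]
    simp

end Euler

/-! ## §2. The curve's depleted plus symbol, in the crux's own form, is full-Hecke eigen -/

section Curve

variable {W : WeierstrassCurve ℚ} [W.IsElliptic] [W.IsGloballyMinimal] [NeZero (W.conductorNorm ℤ)]
  {f : CuspForm (CongruenceSubgroup.Gamma0 (W.conductorNorm ℤ)) 2}

/-- **`T_q φ^{S₀}_W = a_q(W)·φ^{S₀}_W` off `S₀`, crux form**: as `heckeT_depletedCurveSymbol`, with the Euler polynomials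
written `L_v(W,X)` (`(W.localPolynomialAt v).map ℤ→ℚ̄₂`) exactly as in the crux and in
`depletedCurveLayer_eq_layerSum_depletedSymbol`. [cite: GreenbergVatsal2000, §1 (8) and §3] -/
theorem heckeT_depletedCurveSymbol_localPolynomialAt (hf : IsNewformOf W f)
    (S₀ : Finset (IsDedekindDomain.HeightOneSpectrum (NumberField.RingOfIntegers ℚ))) {q : ℕ} (hq : q.Prime)
    (hqS : ∀ v ∈ S₀, Rat.HeightOneSpectrum.natGenerator v ≠ q) (r : ℚ) :
    (W.LFunction q : PadicAlgCl 2) * (∑ k ∈ Fintype.piFinset (fun _ : S₀ ↦ Finset.range 3),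
        (∏ v : S₀, ((W.localPolynomialAt (v : IsDedekindDomain.HeightOneSpectrum (NumberField.RingOfIntegers ℚ))).map (Int.castRingHom (PadicAlgCl 2))).coeff (k v) *
            ((Rat.HeightOneSpectrum.natGenerator (v : IsDedekindDomain.HeightOneSpectrum (NumberField.RingOfIntegers ℚ)) : PadicAlgCl 2)⁻¹) ^ (k v)) *
          algebraMap ℚ (PadicAlgCl 2) (ratPlusSymbol f (r * ((∏ v : S₀, Rat.HeightOneSpectrum.natGenerator (v : IsDedekindDomain.HeightOneSpectrum (NumberField.RingOfIntegers ℚ)) ^ (k v) : ℕ) : ℚ)))) =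
      (∑ j : Fin q, ∑ k ∈ Fintype.piFinset (fun _ : S₀ ↦ Finset.range 3),
        (∏ v : S₀, ((W.localPolynomialAt (v : IsDedekindDomain.HeightOneSpectrum (NumberField.RingOfIntegers ℚ))).map (Int.castRingHom (PadicAlgCl 2))).coeff (k v) *
            ((Rat.HeightOneSpectrum.natGenerator (v : IsDedekindDomain.HeightOneSpectrum (NumberField.RingOfIntegers ℚ)) : PadicAlgCl 2)⁻¹) ^ (k v)) *
          algebraMap ℚ (PadicAlgCl 2) (ratPlusSymbol f ((r + j) / q * ((∏ v : S₀, Rat.HeightOneSpectrum.natGenerator (v : IsDedekindDomain.HeightOneSpectrum (NumberField.RingOfIntegers ℚ)) ^ (k v) : ℕ) : ℚ)))) +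
      (if q ∣ W.conductorNorm ℤ then 0 else (q : PadicAlgCl 2)) * (q : PadicAlgCl 2)⁻¹ *
        ∑ k ∈ Fintype.piFinset (fun _ : S₀ ↦ Finset.range 3),
          (∏ v : S₀, ((W.localPolynomialAt (v : IsDedekindDomain.HeightOneSpectrum (NumberField.RingOfIntegers ℚ))).map (Int.castRingHom (PadicAlgCl 2))).coeff (k v) *
              ((Rat.HeightOneSpectrum.natGenerator (v : IsDedekindDomain.HeightOneSpectrum (NumberField.RingOfIntegers ℚ)) : PadicAlgCl 2)⁻¹) ^ (k v)) *
            algebraMap ℚ (PadicAlgCl 2) (ratPlusSymbol f ((q : ℚ) * r * ((∏ v : S₀, Rat.HeightOneSpectrum.natGenerator (v : IsDedekindDomain.HeightOneSpectrum (NumberField.RingOfIntegers ℚ)) ^ (k v) : ℕ) : ℚ))) := by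
  simp only [map_localPolynomialAt_eq W]
  exact heckeT_depletedCurveSymbol hf S₀ hq hqS r

/-- **`U_ℓ φ^{S₀}_W = 0` on `S₀`, crux form**: as `heckeU_depletedCurveSymbol_eq_zero`, with the Euler polynomials written
`L_v(W,X)` exactly as in the crux. [cite: GreenbergVatsal2000, §1 (8) and §3] -/
theorem heckeU_depletedCurveSymbol_localPolynomialAt_eq_zero (hf : IsNewformOf W f)
    (S₀ : Finset (IsDedekindDomain.HeightOneSpectrum (NumberField.RingOfIntegers ℚ)))
    {v₀ : IsDedekindDomain.HeightOneSpectrum (NumberField.RingOfIntegers ℚ)} (hv₀ : v₀ ∈ S₀) (r : ℚ) :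
    ∑ j : Fin (Rat.HeightOneSpectrum.natGenerator v₀), ∑ k ∈ Fintype.piFinset (fun _ : S₀ ↦ Finset.range 3),
        (∏ v : S₀, ((W.localPolynomialAt (v : IsDedekindDomain.HeightOneSpectrum (NumberField.RingOfIntegers ℚ))).map (Int.castRingHom (PadicAlgCl 2))).coeff (k v) *
            ((Rat.HeightOneSpectrum.natGenerator (v : IsDedekindDomain.HeightOneSpectrum (NumberField.RingOfIntegers ℚ)) : PadicAlgCl 2)⁻¹) ^ (k v)) *
          algebraMap ℚ (PadicAlgCl 2) (ratPlusSymbol f ((r + j) / (Rat.HeightOneSpectrum.natGenerator v₀) *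
            ((∏ v : S₀, Rat.HeightOneSpectrum.natGenerator (v : IsDedekindDomain.HeightOneSpectrum (NumberField.RingOfIntegers ℚ)) ^ (k v) : ℕ) : ℚ))) = 0 := by
  simp only [map_localPolynomialAt_eq W]
  exact heckeU_depletedCurveSymbol_eq_zero hf S₀ hv₀ r

end Curve

end Summit.BirchSwinnertonDyer.BirchSwinnertonDyer.Theorems.ThetaLayerLambdaCongruenceAtTwo

end
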